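import Summits.KontsevichZagierPeriods.KontsevichZagierPeriods.Theorems.LogPrimitiveNL.Negative.Rigidity
import Summits.KontsevichZagierPeriods.KontsevichZagierPeriods.Theorems.LiouvilleUnfoldingLogPrimitiveNLGlue
import Summits.KontsevichZagierPeriods.KontsevichZagierPeriods.Theorems.LiouvilleUnfoldingLogPrimitiveNLStubMinNormalisation
import Summits.KontsevichZagierPeriods.KontsevichZagierPeriods.Theorems.LiouvilleUnfoldingLogPrimitiveNLStubTransfer
import Summits.KontsevichZagierPeriods.KontsevichZagierPeriods.Theorems.LiouvilleUnfoldingLogPrimitiveNLStubConeDecomposition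
import Summits.KontsevichZagierPeriods.KontsevichZagierPeriods.Theorems.LiouvilleUnfoldingLogPrimitiveNLStubCellwiseFold
import Summits.KontsevichZagierPeriods.KontsevichZagierPeriods.Theorems.LiouvilleUnfoldingLogPrimitiveNLStubConstBlockDescent
import Summits.KontsevichZagierPeriods.KontsevichZagierPeriods.Theorems.LiouvilleUnfoldingLogPrimitiveNLStubTaylorMorphism
import Summits.KontsevichZagierPeriods.KontsevichZagierPeriods.Theorems.LiouvilleUnfoldingLogPrimitiveNLStubOneVarSemialgebraic
import Summits.KontsevichZagierPeriods.KontsevichZagierPeriods.Theorems.LiouvilleUnfoldingLogPrimitiveNLStubRosenlichtProperty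
import Summits.KontsevichZagierPeriods.KontsevichZagierPeriods.Theorems.LiouvilleUnfoldingLogPrimitiveNLStubAbstractLogLinear
import Summits.KontsevichZagierPeriods.KontsevichZagierPeriods.Theorems.LiouvilleUnfoldingLogPrimitiveNLStubUniformCells
import Literature.NumberTheory.Transcendental.KZLogCalculusProofs
import Literature.NumberTheory.Transcendental.SemialgebraicDerivativeProofs
import Literature.RingTheory.PowerSeries.LaurentSeriesConstants

/-!
# Line `ax-schanuel-germs` for crux `LogPrimitiveNL` (stmt-KontsevichZagierPeriods-2836) — skeleton
(second lead, unit `line-stmt-KontsevichZagierPeriods-2836-b`)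

Composition (sorry-free glue at the end): the crux BY NAME is
`stub_transfer stub_minNormalisation boundaryRigidity_of_stubs`, exactly as in line `logderiv-peeling`
(shared transfer layer, T1 already LANDED by the first lead and imported here); boundary rigidity is
`stub_cellwiseFold stub_coneDecomposition` (shared fold layer, verbatim) on top of the STRUCTURE
theorem `stub_structure` (this line's engine), whose registered hypotheses are the six engine stubs:

* `stub_taylorMorphism` — the `C^∞` Taylor morphism at `0` from real germs into `ℝ⸨X⸩`
  (`LaurentSeries ℝ`): local, additive, multiplicative, intertwines `deriv` with
  `LaurentSeries.derivative`, constants `↦ C`, `id ↦ X`, kernel = flat germs, constant term = value.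
* `stub_oneVarSemialgebraic` — one-variable real-semialgebraic toolkit: a function semialgebraic
  over `ℝ` on an interval satisfies a non-trivial polynomial identity `q(φ t, t) = 0`, and a `C^∞`
  such function that is FLAT at `0` vanishes near `0` (replaces analyticity / the Nash upgrade).
* `stub_rosenlichtProperty` — in the differential field `(ℝ⸨X⸩, d/dX)`: the elements algebraic over
  `ℝ(X)` are stable under `d/dX`, and Rosenlicht's Prop. 4 holds for them relative to the constants
  (`Σ cⱼ duⱼ/uⱼ + dv = 0`, `cⱼ` constants `ℚ`-independent, `uⱼ, v` algebraic over `ℝ(X)` ⇒ `duⱼ = 0`),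
  from the tree's `Rosenlicht.isAlgebraic_of_forall_derivation`.
* `stub_abstractLogLinear` — pure differential algebra (the linear shadow of Ax–Schanuel, dual form):
  over a `D`-stable subfield `F` containing the constants and having the Rosenlicht property,
  a relation `Σ ηᵢ yᵢ = g` with `ηᵢ, g ∈ F`, `D yᵢ = D wᵢ / wᵢ`, `wᵢ ∈ Fˣ` forces `Σ pᵢ ηᵢ = 0` for
  every integer `p` orthogonal to the lattice `{f ∈ ℤᵏ | D (Σ fᵢ yᵢ) = 0}`; plus the real
  double-orthogonal lemma for integer vectors.
* `stub_constBlockDescent` — the constant block (Baker in relation-span form at rational points,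
  density, continuity): `Σ q_r(x) log θ_r = g(x)` with `θ_r` positive algebraic NUMBERS forces
  `q(x) ∈ span_ℝ {m ∈ ℤᴿ | Π θ_r^{m_r} = 1}`.
* `stub_uniformCells` — finitely many disjoint open preconnected `ℚ`-semialgebraic cells, co-null,
  on which all data are `C^∞` and, for EVERY `f ∈ ℤᵏ`, either `W^f` is constant on the cell or the
  zero set of the log-gradient `Σ fᵢ ∇Wᵢ/Wᵢ` has empty interior in the cell (cells of constancy of
  the local kernel of the log-gradient matrix).

`stub_structure` (held by the lead) assembles them: on a cell, at an a.e. (good) point and along a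
generic direction, the Taylor morphism carries the one-variable restriction into `ℝ⸨X⸩`, the abstract
theorem applies with `F` = the relative algebraic closure of `ℝ(X)`, flatness identifies the abstract
lattice with the cell's lattice, whence `h(x) ∈ span_ℝ Λ(cell)`; then the constant block and the
rational reproducing matrix (`descent_lattice_reproduce`, landed) give the registered conclusion
(identical to line `logderiv-peeling`'s `stub_descent` conclusion, so the shared glue applies).

Shared layer with line `logderiv-peeling` (LANDED, imported): `stub_minNormalisation`, `stub_transfer`,
`stub_coneDecomposition`, `stub_cellwiseFold`.
-/

noncomputable section

open Set MeasureTheory Filter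
open scoped ContDiff Topology LaurentSeries RatFunc
open Literature.NumberTheory.Transcendental Literature.ModelTheory.ExponentialFields

namespace Summit.KontsevichZagierPeriods.LiouvilleUnfolding.LogPrimitiveNL.AxSchanuelGerms

open Summit.KontsevichZagierPeriods.KontsevichZagierPeriods.Theses.LiouvilleUnfolding (LogPrimitiveNL)

/-! ## Engine stubs (this line) -/

-- `stub_taylorMorphism`: LANDED (p81058, Theorems/LiouvilleUnfoldingLogPrimitiveNLStubTaylorMorphism.lean), imported.

-- `stub_oneVarSemialgebraic`: LANDED (p81165, Theorems/LiouvilleUnfoldingLogPrimitiveNLStubOneVarSemialgebraic.lean), imported.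

-- `stub_rosenlichtProperty`: LANDED (p81921, Theorems/LiouvilleUnfoldingLogPrimitiveNLStubRosenlichtProperty.lean), imported.

-- `stub_abstractLogLinear`: LANDED (p82404, Theorems/LiouvilleUnfoldingLogPrimitiveNLStubAbstractLogLinear.lean), imported.

-- `stub_constBlockDescent`: LANDED (p80616, Theorems/LiouvilleUnfoldingLogPrimitiveNLStubConstBlockDescent.lean), imported.

-- `stub_uniformCells`: LANDED (p84493, Theorems/LiouvilleUnfoldingLogPrimitiveNLStubUniformCells.lean), imported.

/-- **STRUCTURE THEOREM** (this line's hardest stub, held by the lead): from the six engine stubs,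
the structure of `ℚ`-semialgebraic log-linear identities `Σ hᵢ log Wᵢ = g` on a `ℚ`-semialgebraic
`U`: finitely many disjoint open semialgebraic cells, co-null, on each of which `g ≡ 0` and
`h = Σ_r q_r f_r` with `q_r` `ℚ`-semialgebraic and exact multiplicative relations `Π Wᵢ^{f_r i} ≡ 1`
(conclusion verbatim that of line `logderiv-peeling`'s `stub_descent`, so the fold glue is shared).
Proof route: uniform cells; on a cell, at a good point (a.e.: off countably many null semialgebraic
zero sets) and along a direction avoiding countably many hyperplanes, restrict to the line, apply the
Taylor morphism into `ℝ⸨X⸩`, the abstract theorem with `F` = algebraic elements over `ℝ(X)`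
(polynomial identities of the one-variable toolkit give membership, the Rosenlicht property its
hypothesis), identify the abstract lattice with the cell lattice by flatness, conclude
`h(x₀) ∈ span_ℝ Λ(cell)` by double orthogonality, spread by density + continuity; constant block on
the cell lattice's constants; rational reproducing matrix (`descent_lattice_reproduce`). -/
theorem stub_structure :
    (∃ T : (ℝ → ℝ) → ℝ⸨X⸩,
      (∀ f g : ℝ → ℝ, f =ᶠ[𝓝 0] g → T f = T g) ∧
      (∀ f g : ℝ → ℝ, (∃ U ∈ 𝓝 (0 : ℝ), ContDiffOn ℝ ∞ f U) →
        (∃ U ∈ 𝓝 (0 : ℝ), ContDiffOn ℝ ∞ g U) →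
          T (f + g) = T f + T g ∧ T (f * g) = T f * T g) ∧
      (∀ f : ℝ → ℝ, (∃ U ∈ 𝓝 (0 : ℝ), ContDiffOn ℝ ∞ f U) →
        T (deriv f) = LaurentSeries.derivative ℝ (T f)) ∧
      (∀ c : ℝ, T (fun _ => c) = HahnSeries.C c) ∧
      T (fun t => t) = HahnSeries.single 1 1 ∧
      (∀ f : ℝ → ℝ, ∃ p : PowerSeries ℝ, T f = HahnSeries.ofPowerSeries ℤ ℝ p) ∧
      (∀ f : ℝ → ℝ, (T f).coeff 0 = f 0) ∧
      (∀ f : ℝ → ℝ, (∃ U ∈ 𝓝 (0 : ℝ), ContDiffOn ℝ ∞ f U) →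
        (T f = 0 ↔ ∀ n : ℕ, iteratedDeriv n f 0 = 0))) →
    ((∀ (φ : ℝ → ℝ) (a b : ℝ), a < b →
      IsSemialgebraicFunOn ℝ {x : Fin 1 → ℝ | x 0 ∈ Ioo a b} (fun x => φ (x 0)) →
        ∃ q : MvPolynomial (Fin 2) ℝ, q ≠ 0 ∧
          ∀ t ∈ Ioo a b, MvPolynomial.eval (Fin.cons (φ t) fun _ => t) q = 0) ∧
    (∀ (φ : ℝ → ℝ) (ε : ℝ), 0 < ε →
      IsSemialgebraicFunOn ℝ {x : Fin 1 → ℝ | x 0 ∈ Ioo (-ε) ε} (fun x => φ (x 0)) →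
        ContDiffOn ℝ ∞ φ (Ioo (-ε) ε) → (∀ n : ℕ, iteratedDeriv n φ 0 = 0) →
          ∀ᶠ t in 𝓝 (0 : ℝ), φ t = 0)) →
    ((∀ x : ℝ⸨X⸩, IsAlgebraic (RatFunc ℝ) x →
      IsAlgebraic (RatFunc ℝ) (LaurentSeries.derivative ℝ x)) ∧
    (∀ (m : ℕ) (e : Fin m → ℝ) (u : Fin m → ℝ⸨X⸩) (v : ℝ⸨X⸩), LinearIndependent ℚ e →
      (∀ j, IsAlgebraic (RatFunc ℝ) (u j)) → (∀ j, u j ≠ 0) → IsAlgebraic (RatFunc ℝ) v →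
      (∑ j, HahnSeries.C (e j) * ((u j)⁻¹ * LaurentSeries.derivative ℝ (u j))) +
          LaurentSeries.derivative ℝ v = 0 →
        ∀ j, LaurentSeries.derivative ℝ (u j) = 0)) →
    ((∀ (L : Type) [Field L] [CharZero L] (D : Derivation ℤ L L) (F : Subfield L),
      (∀ x ∈ F, D x ∈ F) → (∀ x, D x = 0 → x ∈ F) →
      (∀ (m : ℕ) (c u : Fin m → L) (v : L), (∀ j, D (c j) = 0) → LinearIndependent ℚ c →
        (∀ j, u j ∈ F) → (∀ j, u j ≠ 0) → v ∈ F →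
        (∑ j, c j * ((u j)⁻¹ * D (u j))) + D v = 0 → ∀ j, D (u j) = 0) →
      ∀ (k : ℕ) (η w y : Fin k → L) (g : L), (∀ i, η i ∈ F) → (∀ i, w i ∈ F) →
        (∀ i, w i ≠ 0) → (∀ i, D (y i) = (w i)⁻¹ * D (w i)) → g ∈ F →
        ∑ i, η i * y i = g →
        ∀ p : Fin k → ℤ,
          (∀ f : Fin k → ℤ, D (∑ i, (f i : L) * y i) = 0 → ∑ i, p i * f i = 0) →
          ∑ i, (p i : L) * η i = 0) ∧
    (∀ (k : ℕ) (S : Set (Fin k → ℤ)) (v : Fin k → ℝ),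
      (∀ p : Fin k → ℤ, (∀ f ∈ S, ∑ i, p i * f i = 0) → ∑ i, (p i : ℝ) * v i = 0) →
      v ∈ Submodule.span ℝ {φ : Fin k → ℝ | ∃ f ∈ S, φ = fun i => (f i : ℝ)})) →
    (∀ (n R : ℕ) (C : Set (Fin n → ℝ)) (q : Fin R → (Fin n → ℝ) → ℝ) (g : (Fin n → ℝ) → ℝ)
      (θ : Fin R → ℝ), IsSemialgebraic ℚ C → IsOpen C →
      (∀ r, IsSemialgebraicFunOn ℚ C (q r)) → (∀ r, ContinuousOn (q r) C) →
      IsSemialgebraicFunOn ℚ C g → (∀ r, IsAlgebraic ℚ (θ r)) → (∀ r, 0 < θ r) →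
      (∀ x ∈ C, ∑ r, q r x * Real.log (θ r) = g x) →
      ∀ x ∈ C, (fun r => q r x) ∈ Submodule.span ℝ
        {φ : Fin R → ℝ | ∃ m : Fin R → ℤ, ∏ r, θ r ^ (m r) = 1 ∧ φ = fun r => (m r : ℝ)}) →
    (∀ (n k M : ℕ) (U : Set (Fin n → ℝ)) (W : Fin k → (Fin n → ℝ) → ℝ)
      (F : Fin M → (Fin n → ℝ) → ℝ), IsSemialgebraic ℚ U →
      (∀ i, IsSemialgebraicFunOn ℚ U (W i)) → (∀ i, ∀ x ∈ U, 0 < W i x) →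
      (∀ m, IsSemialgebraicFunOn ℚ U (F m)) →
      ∃ (N : ℕ) (C : Fin N → Set (Fin n → ℝ)),
        (∀ c, IsSemialgebraic ℚ (C c) ∧ IsOpen (C c) ∧ IsPreconnected (C c) ∧ C c ⊆ U) ∧
        Pairwise (Function.onFun Disjoint C) ∧ volume (U \ ⋃ c, C c) = 0 ∧
        (∀ c i, ContDiffOn ℝ ∞ (W i) (C c)) ∧ (∀ c m, ContDiffOn ℝ ∞ (F m) (C c)) ∧
        ∀ c (f : Fin k → ℤ),
          (∃ θ : ℝ, ∀ x ∈ C c, ∏ i, W i x ^ (f i) = θ) ∨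
          interior {x ∈ C c | ∀ j : Fin n,
            ∑ i, (f i : ℝ) * (fderiv ℝ (W i) x (Pi.single j 1) / W i x) = 0} = ∅) →
    ∀ (n k : ℕ) (U : Set (Fin n → ℝ)) (h W : Fin k → (Fin n → ℝ) → ℝ) (g : (Fin n → ℝ) → ℝ),
      IsSemialgebraic ℚ U → (∀ i, IsSemialgebraicFunOn ℚ U (h i)) →
      (∀ i, IsSemialgebraicFunOn ℚ U (W i)) → (∀ i, ∀ x ∈ U, 0 < W i x) →
      IsSemialgebraicFunOn ℚ U g → (∀ x ∈ U, ∑ i, h i x * Real.log (W i x) = g x) →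
      ∃ (N : ℕ) (C : Fin N → Set (Fin n → ℝ)),
        (∀ c, IsSemialgebraic ℚ (C c) ∧ IsOpen (C c) ∧ C c ⊆ U) ∧
        Pairwise (Function.onFun Disjoint C) ∧ volume (U \ ⋃ c, C c) = 0 ∧
        ∀ c, (∀ x ∈ C c, g x = 0) ∧
          ∃ (R : ℕ) (f : Fin R → Fin k → ℤ) (q : Fin R → (Fin n → ℝ) → ℝ),
            (∀ r, IsSemialgebraicFunOn ℚ (C c) (q r)) ∧
            (∀ r, ∀ x ∈ C c, ∏ i, W i x ^ (f r i) = 1) ∧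
            (∀ i, ∀ x ∈ C c, h i x = ∑ r, q r x * (f r i : ℝ)) := by
  sorry

/-! ## Shared layer: line `logderiv-peeling`'s LANDED stubs `stub_transfer`, `stub_coneDecomposition`,
`stub_cellwiseFold` (imported; namespace `…LogPrimitiveNL`, resolved from this sub-namespace). -/

/-! ## Glue (sorry-free) -/

/-- **Structure + fold ⇒ boundary rigidity.** The structure theorem (applied to
`g.integrand = Σ hᵢ log Wᵢ` on `g.domain`) gives cells on which `g.integrand = 0` — so `[g]` is a
relation (`of_mem_relations_of_eqOn_zero_off_null`, landed glue of line `logderiv-peeling`) — and the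
lattice structure that the shared cellwise fold turns into `Σ [Uᵢ] ∈ relations`. -/
theorem boundaryRigidity_of_stubs : Negative.BoundaryRigidity := by
  intro n k g h W U hh hW hW1 hUd hUi hUint hg
  have hσ : IsSemialgebraic ℚ g.domain := g.isSemialgebraic_domain
  have hWpos : ∀ i, ∀ x ∈ g.domain, 0 < W i x := fun i x hx => one_pos.trans_le (hW1 i x hx)
  obtain ⟨N, C, hC, hdisj, hnull, hcell⟩ :=
    stub_structure stub_taylorMorphism stub_oneVarSemialgebraic stub_rosenlichtProperty
      stub_abstractLogLinear stub_constBlockDescent stub_uniformCells n k g.domain h W g.integrand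
      hσ hh hW hWpos g.isSemialgebraicFunOn_integrand (fun x hx => (hg x hx).symm)
  have hfold : ∑ i, KZ.of (U i) ∈ KZ.relations :=
    stub_cellwiseFold stub_coneDecomposition n k g.domain h W U N C hσ hh hW hW1 hUd hUi hUint hC
      hdisj hnull (fun c => (hcell c).2)
  have hA : IsSemialgebraic ℚ (⋃ c, C c) := by
    have : (⋃ c, C c) = ⋃ c ∈ (Finset.univ : Finset (Fin N)), C c := by simp
    rw [this]
    exact IsSemialgebraic.biUnion _ _ fun c _ => (hC c).1
  have hg0 : KZ.of g ∈ KZ.relations := by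
    refine of_mem_relations_of_eqOn_zero_off_null n g (⋃ c, C c) hA
      (iUnion_subset fun c => (hC c).2.2) hnull fun x hx => ?_
    obtain ⟨c, hxc⟩ := mem_iUnion.1 hx
    exact (hcell c).1 x hxc
  exact KZ.relations.sub_mem hfold hg0

/-- **The composition**: the crux `LogPrimitiveNL`, BY NAME, from the stubs (shared transfer with the
LANDED min-normalisation `stub_minNormalisation` of line `logderiv-peeling`). -/
theorem LogPrimitiveNL_of : LogPrimitiveNL :=
  fun n k r r' a b h V V' =>
    stub_transfer stub_minNormalisation boundaryRigidity_of_stubs n k r r' a b h V V'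

end Summit.KontsevichZagierPeriods.LiouvilleUnfolding.LogPrimitiveNL.AxSchanuelGerms

end

#h21_check_skeleton "stmt-KontsevichZagierPeriods-2836" Summit.KontsevichZagierPeriods.KontsevichZagierPeriods.Theses.LiouvilleUnfolding.LogPrimitiveNL stub_structure
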